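import Summits.KontsevichZagierPeriods.KontsevichZagierPeriods.Theorems.TerasomaMultiplicationGammaHodgeSectorCompiler
import Summits.KontsevichZagierPeriods.KontsevichZagierPeriods.Theorems.GammaHodgeSector.Negative.Fermat33

/-!
# `GammaHodgeSector` (stmt-KontsevichZagierPeriods-3742), instance line `InstanceSixtySix`:
stub `stub_pair66_of_gammaHodgePairs` — the level-66 linear Beta pair is solved by the divisor range

The ONE extra solved pair fed to the parametric relator compiler by the line is the level-66 linear
Beta identity `B(1/22, 1/3) = c · B(1/22, 16/33)`, `c = Γ(1/3)Γ(35/66)/(Γ(25/66)Γ(16/33)) ≈ 1.0461`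
(the factors `Γ(1/22)` cancel; `1/22 + 1/3 = 25/66`, `1/22 + 16/33 = 35/66`) — a CM isogeny between
two factors of `J(F₆₆)`: for every `u` coprime to `66`,
`{u/22} + {u/3} − {25u/66} = {u/22} + {16u/33} − {35u/66}`, i.e. the Γ-monomial
`Γ(22/66)Γ(35/66)Γ(25/66)⁻¹Γ(32/66)⁻¹` is of Hodge type with weight `0`, hence algebraic by the
tree's PROVED Koblitz–Ogus discharge `deligne_gammaMonomial_algebraic_holds`.

This file proves the registered stub: the pair is SOLVED in the formal period ring `P`
(`IsConstMultiple (betaClass (1/22) (1/3)) (betaClass (1/22) (16/33))`, i.e.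
`β(1/22,1/3) = κ(q)·β(1/22,16/33)` for a positive real algebraic `q`) as soon as the divisor-range
crux `GammaHodgePairs` (stmt-3743) holds — the instance `(N, N', k) = (1, 1, 0)` of the landed
`GammaHodgeSectorKO.isConstMultiple_of_gammaHodgePairs`, whose arithmetic side conditions
(admissibility, the Hodge-type test at `D = 66`, algebraicity of `c`, the Deligne identity) are all
discharged here. References: Deligne LNM 900 §7, Thm. 7.18 and Rem. 7.16 (a) (Koblitz–Ogus);
Kontsevich–Zagier 2001 §1.2.
-/

noncomputable section

open MeasureTheory Set
open scoped BigOperators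

namespace Summit.KontsevichZagierPeriods.GammaHodgeSectorRaise66

open Literature.NumberTheory.Transcendental
open Literature.NumberTheory.Transcendental.KZ
open Literature.NumberTheory.Transcendental.BetaSymbol
open Summit.KontsevichZagierPeriods.GammaHodgeSectorKO
open Summit.KontsevichZagierPeriods.GammaHodgeSectorNegative
open Summit.KontsevichZagierPeriods.KontsevichZagierPeriods.Theses.TerasomaMultiplication
  (GammaHodgeSector MultiplicationAccessible BetaCancellation)
open Summit.KontsevichZagierPeriods.KontsevichZagierPeriods.Theses.MotivatedMoves (GammaHodgePairs)

/-! ## The datum `(N, N', k) = (1, 1, 0)`, `(x, y) = (1/22, 1/3)`, `(x', y') = (1/22, 16/33)` -/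

/-- The left data `(1/22, 1/3)` are admissible (positive, non-integral). [folklore] -/
theorem admissible_pair66_left : Admissible ![(1:ℚ)/22] ![(1:ℚ)/3] := by
  unfold Admissible
  decide +kernel

/-- The right data `(1/22, 16/33)` are admissible (positive, non-integral). [folklore] -/
theorem admissible_pair66_right : Admissible ![(1:ℚ)/22] ![(16:ℚ)/33] := by
  unfold Admissible
  decide +kernel

/-- **The level-66 pair passes the Hodge-type test of the crux with `k = 0`** (`N = N' = 1`): for
every `u` coprime to `66`, `{u/22} + {u/3} − {25u/66} = {u/22} + {16u/33} − {35u/66}` (equal CM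
types) — the finite form of the test at `D = 66`, by `decide`. [folklore] -/
theorem hodgeCondition_pair66 :
    HodgeCondition 1 1 0 ![(1:ℚ)/22] ![(1:ℚ)/3] ![(1:ℚ)/22] ![(16:ℚ)/33] := by
  rw [hodgeCondition_iff_le (D := 66) (by norm_num) (by decide +kernel) (by decide +kernel)
    (by decide +kernel) (by decide +kernel) (by decide +kernel) (by decide +kernel)]
  unfold hodgeSum CoprimeDen
  decide +kernel

/-! ## The constant `c = Γ(1/3)Γ(35/66)/(Γ(25/66)Γ(16/33))` is algebraic (Koblitz–Ogus) -/

/-- Product expansion over `{1,…,65}` against the multiplicity vector of the Γ-monomial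
`Γ(22/66)Γ(35/66)Γ(25/66)⁻¹Γ(32/66)⁻¹` (support `{22, 25, 32, 35}`). [folklore] -/
theorem pair66_multiplicities_prod (G : ℕ → ℂ) :
    ∏ i ∈ Finset.Ico 1 66,
      G i ^ ((fun i : ℕ => if i = 22 then (1:ℤ) else if i = 35 then 1 else if i = 25 then -1
        else if i = 32 then -1 else 0) i) = G 22 * G 35 * (G 25)⁻¹ * (G 32)⁻¹ := by
  rw [Finset.prod_Ico_eq_prod_range]
  simp only [Finset.prod_range_succ, Finset.prod_range_zero, Nat.reduceSub, Nat.reduceAdd,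
    Nat.reduceEqDiff, ↓reduceIte, zpow_zero, zpow_one, zpow_neg, one_mul, mul_one]
  ring

/-- **The Hodge-type test for the Γ-monomial** `[22/66] + [35/66] − [25/66] − [32/66]` (weight `0`):
`{22u/66} + {35u/66} = {25u/66} + {32u/66}` for every `u` coprime to `66` — a finite check on
`u mod 66` (`isHodgeTypeGammaMonomial_of_lt`), by `decide`. [folklore] -/
theorem pair66_isHodgeType :
    IsHodgeTypeGammaMonomial 66 (fun i : ℕ => if i = 22 then (1:ℤ) else if i = 35 then 1
      else if i = 25 then -1 else if i = 32 then -1 else 0) 0 := by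
  refine isHodgeTypeGammaMonomial_of_lt (by norm_num) ?_
  decide +kernel

/-- **The constant of the pair is algebraic**: `Γ(1/3)Γ(35/66)Γ(25/66)⁻¹Γ(16/33)⁻¹ ∈ ℚ̄ ∩ ℝ`, from
the tree's discharge of Deligne's Thm 7.18 (a) à la Koblitz–Ogus
(`deligne_gammaMonomial_algebraic_holds`) applied to the Hodge-type monomial of
`pair66_isHodgeType` (`d = 66`, weight `0`, so no power of `2πi`), transferred from `ℂ` to `ℝ`.
[cite: Deligne1982HodgeCycles, Thm. 7.18 (a)] -/
theorem pair66_constant_isAlgebraic :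
    IsAlgebraic ℚ (Real.Gamma (1/3) * Real.Gamma (35/66) * (Real.Gamma (25/66))⁻¹ *
      (Real.Gamma (16/33))⁻¹) := by
  have hKO := deligne_gammaMonomial_algebraic_holds 66 _ 0 (by norm_num) pair66_isHodgeType
  unfold gammaTilde at hKO
  rw [pair66_multiplicities_prod, neg_zero, zpow_zero, one_mul] at hKO
  have hval : (Real.Gamma (((22 : ℕ) : ℝ) / (66 : ℕ)) : ℂ) *
      (Real.Gamma (((35 : ℕ) : ℝ) / (66 : ℕ)) : ℂ) *
      ((Real.Gamma (((25 : ℕ) : ℝ) / (66 : ℕ)) : ℂ))⁻¹ *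
      ((Real.Gamma (((32 : ℕ) : ℝ) / (66 : ℕ)) : ℂ))⁻¹ =
      algebraMap ℝ ℂ (Real.Gamma (1/3) * Real.Gamma (35/66) * (Real.Gamma (25/66))⁻¹ *
        (Real.Gamma (16/33))⁻¹) := by
    rw [Complex.coe_algebraMap]
    push_cast
    norm_num
  rw [hval, isAlgebraic_algebraMap_iff (RCLike.ofReal_injective (K := ℂ))] at hKO
  exact hKO

/-- **The Deligne identity of the pair** (`k = 0`): `B(1/22, 1/3) = c · π⁰ · B(1/22, 16/33)` with
`c = Γ(1/3)Γ(35/66)Γ(25/66)⁻¹Γ(16/33)⁻¹` — `Γ(1/22)` cancels, `1/22 + 1/3 = 25/66`,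
`1/22 + 16/33 = 35/66`. [folklore] -/
theorem deligneIdentity_pair66 :
    DeligneIdentity 0 ![(1:ℚ)/22] ![(1:ℚ)/3] ![(1:ℚ)/22] ![(16:ℚ)/33]
      (Real.Gamma (1/3) * Real.Gamma (35/66) * (Real.Gamma (25/66))⁻¹ * (Real.Gamma (16/33))⁻¹) := by
  unfold DeligneIdentity
  simp only [Fin.prod_univ_one, Matrix.cons_val_fin_one, pow_zero, mul_one, ProbabilityTheory.beta]
  have h25 : Real.Gamma ((25:ℝ)/66) ≠ 0 := (Real.Gamma_pos_of_pos (by norm_num)).ne'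
  have h35 : Real.Gamma ((35:ℝ)/66) ≠ 0 := (Real.Gamma_pos_of_pos (by norm_num)).ne'
  have h16 : Real.Gamma ((16:ℝ)/33) ≠ 0 := (Real.Gamma_pos_of_pos (by norm_num)).ne'
  push_cast
  rw [show ((1:ℝ)/22 + 1/3) = 25/66 by norm_num, show ((1:ℝ)/22 + 16/33) = 35/66 by norm_num]
  field_simp

/-! ## The stub -/

/-- **The level-66 pair is solved by the divisor range of the crux**: under `GammaHodgePairs`
(crux stmt-3743), `β(1/22,1/3) = κ(q)·β(1/22,16/33)` in `P` for a positive real algebraic `q`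
(namely `q = Γ(1/3)Γ(35/66)Γ(25/66)⁻¹Γ(16/33)⁻¹`, algebraic by Koblitz–Ogus): the instance
`(N, N', k) = (1, 1, 0)` of `isConstMultiple_of_gammaHodgePairs`, the word multisets over `Fin 1`
being the singletons `{(1/22,1/3)}`, `{(1/22,16/33)}`. [cite: Deligne1982HodgeCycles, Thm. 7.18] -/
theorem stub_pair66_of_gammaHodgePairs (hP : GammaHodgePairs) :
    IsConstMultiple (betaClass (1/22) (1/3)) (betaClass (1/22) (16/33)) := by
  have h := isConstMultiple_of_gammaHodgePairs hP (k := 0) (show 1 + 1 = 2 from rfl)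
    ![(1:ℚ)/22] ![(1:ℚ)/3] ![(1:ℚ)/22] ![(16:ℚ)/33] _ admissible_pair66_left admissible_pair66_right
    hodgeCondition_pair66 pair66_constant_isAlgebraic deligneIdentity_pair66
  rw [zero_smul, add_zero, prodClass_wordMultiset, prodClass_wordMultiset] at h
  simp only [Fin.prod_univ_one, Matrix.cons_val_fin_one] at h
  exact h

end Summit.KontsevichZagierPeriods.GammaHodgeSectorRaise66

end
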